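import Literature.NumberTheory.LFunctions.Zhang2022.Section8Lemma84LBounds
import HarnessLib

/-!
# Zhang (2022), rescue GAP/BED (D-0124 (3)(4)): the FOURTH (A)-door — the exceptional zero `ρ̃` (Lemma 5.5, (5.15)) and
# the zero-free package next to it — under the minimum premise `‖L(1,χ)‖ ≤ 𝓛⁻¹⁵` (GAP G-31 exponent layer)

Topic `Literature/NumberTheory/LFunctions/Zhang2022` (Landau–Siegel audit tree; verdict-neutral).
Y. Zhang, *Discrete mean estimates and the Landau–Siegel zero*, arXiv:2211.02515v1 (2022)
[Zhang2022LandauSiegel] — **an unrefereed manuscript under adjudication; nothing in this file asserts or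
denies its Theorems 1–2, and nothing here is a claim about Landau–Siegel zeros. The programme SEARCHES and
TYPES; no claim about Landau–Siegel zeros, Theorems 1–2 of arXiv:2211.02515 or a repaired Margin232 until a
kernel theorem says so.**

Besides Lemma 5.7 (`‖L′(1,χ)‖ ≫ 1`), Lemma 5.8 (`L(s,χ) = L′(1,χ)(s−1) + O(α₂)`) and the quotient `L(1−β,χ)/(−βL′(1,χ))`
(`RepairGapPartIIIDoors`), the Part-II leaves Lemma 8.4 / Lemma 10.2 (`Skeleton.Lemma84Rel`, `Lemma102RelW`, via
`Lemma84.lemma84Rel_of_lemma83Rel`) consume Assumption (A) through ONE further entry point: the exceptional zero.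
The tree's `Zhang2022.lemma55_exceptionalZero` (Lemma 5.5 first assertion and (5.15): a simple real zero `ρ̃ < 1` with
`1 − ρ̃ ≤ K𝓛⁻²⁰²²`) and `Lemma84.exceptional_package` (that zero together with the classical bound
`‖L(s,χ)⁻¹‖ ≤ C(𝓛 + log(|t|+4))(1 + |s−ρ̃|⁻¹)` on `σ ≥ 1 − c/(𝓛 + log(|t|+4))`, MV Thm 11.4) are keyed to the printed
premise `‖L(1,χ)‖ < 𝓛⁻²⁰²²`. Both rest on the tree's PROVED Hecke–Landau converse
`Literature.NumberTheory.LFunctions.exists_exceptionalZero_of_norm_LFunction_one_lt`, whose premise is only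
`‖L(1,χ)‖ < A/(log 4q)²` and whose output is `1 − β₁ ≤ K‖L(1,χ)‖`. So this door opens under ANY `‖L(1,χ)‖ ≤ 𝓛^{−E}`,
`E > 2`, with `1 − ρ̃ ≤ K𝓛^{−E}`; here the `E = 15` instance the main-term chain uses:

* `lemma55_exceptionalZero_pow15` — the tree's `lemma55_exceptionalZero` verbatim with `2022 ↦ 15` (threshold
  `log D ≥ max 2 (9/A)`): `ρ̃ < 1` simple real zero, `χ² = 1`, `1 − ρ̃ ≤ K𝓛⁻¹⁵`, `1 − ρ̃ ≤ K‖L(1,χ)‖`, uniqueness in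
  `(1 − c/log 4D, 1)`;
* `exceptional_package_pow15` — the tree's `Lemma84.exceptional_package` verbatim with `2022 ↦ 15`.

READING (GAP G-31, as-typed): the exceptional-zero door's own minimum premise is `E > 2` (Hecke–Landau); at `E = 15` it
delivers `1 − ρ̃ ≤ K𝓛⁻¹⁵`, which is what `lemma84_core` / the §12 residue cores need of `ρ̃` (`1 − ρ̃ ≤ α/4`, `≤ 1/(4𝓛)`,
`8e^{9/2}(1+𝓛)𝓛²(1−ρ̃) ≤ ℓ₀/2` for `𝓛` large). The full Lemma 5.5 («no other zeros in `σ > 1 − 2𝓛⁻¹, |t| < 2D`»,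
Deuring–Heilbronn) is a different, undischarged input (`lemma55_of_deuring_heilbronn`) and is not touched here.
Theorems only; no definition, no named fact; nothing about (A) itself.

## References

* Y. Zhang, arXiv:2211.02515v1 (2022), §5 Lemma 5.5 (5.15), p. 11. [cite: Zhang2022LandauSiegel, §5 Lemma 5.5 (5.15)]
* H. L. Montgomery, R. C. Vaughan, *Multiplicative Number Theory I*, CUP 2007, Theorems 11.3–11.4 (11.7), (11.10).
  [cite: MontgomeryVaughan2007, Theorems 11.3–11.4]
-/

noncomputable section

open Complex Real

namespace Literature.NumberTheory.LFunctions.Zhang2022.Repair.Gap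

/-- For every real `M` there is `D₀` with `log D ≥ M` for all `D ≥ D₀`. [folklore] -/
private theorem exists_nat_le_log' (M : ℝ) : ∃ D₀ : ℕ, ∀ D : ℕ, D₀ ≤ D → M ≤ Real.log D := by
  refine ⟨⌈Real.exp M⌉₊ + 1, fun D hD => ?_⟩
  have h1 : Real.exp M ≤ D := by
    have : (⌈Real.exp M⌉₊ : ℝ) + 1 ≤ D := by exact_mod_cast hD
    linarith [Nat.le_ceil (Real.exp M)]
  have hD0 : (0 : ℝ) < D := lt_of_lt_of_le (Real.exp_pos M) h1
  rw [Real.le_log_iff_exp_le hD0]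
  exact h1

/-- `log 4D ≤ 3 log D` once `log D ≥ 1`. [folklore] -/
private theorem log_four_mul_le' {D : ℝ} (hD : 1 ≤ Real.log D) (hD0 : 0 < D) :
    Real.log (4 * D) ≤ 3 * Real.log D := by
  rw [Real.log_mul (by norm_num) hD0.ne']
  have hlog4 : Real.log 4 < 2 := by
    rw [Real.log_lt_iff_lt_exp (by norm_num)]
    have h1 := Real.exp_one_gt_d9
    have h2 : Real.exp 2 = Real.exp 1 * Real.exp 1 := by rw [← Real.exp_add]; norm_num
    nlinarith
  linarith

/-! ## Lemma 5.5, first assertion and (5.15), under `‖L(1,χ)‖ ≤ 𝓛⁻¹⁵` -/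

/-- **Lemma 5.5 (first assertion, (5.15)) under the minimum premise** (twin of `Zhang2022.lemma55_exceptionalZero`,
same absolute `K, c`): there are `D₀`, `K, c > 0` such that for every `D ≥ D₀` and every Dirichlet character
`χ ≠ χ₀ (mod D)` with `‖L(1,χ)‖ ≤ (log D)^{−15}`, `L(s,χ)` has a simple real zero `ρ̃ < 1` with `1 − ρ̃ ≤ K(log D)^{−15}`,
`1 − ρ̃ ≤ K‖L(1,χ)‖`, `ρ̃ ∈ (1 − c/log 4D, 1)` the only real zero there, and `χ² = 1`. From the tree's Hecke–Landau
converse (premise `‖L(1,χ)‖ < A/(log 4D)²`, met once `log D ≥ max 2 (9/A)`).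
[cite: Zhang2022LandauSiegel, §5 Lemma 5.5 (5.15)] [cite: MontgomeryVaughan2007, Theorems 11.3–11.4] -/
theorem lemma55_exceptionalZero_pow15 :
    ∃ D₀ : ℕ, ∃ K : ℝ, 0 < K ∧ ∃ c : ℝ, 0 < c ∧
      ∀ (D : ℕ) [NeZero D], D₀ ≤ D → ∀ χ : DirichletCharacter ℂ D, χ ≠ 1 →
        ‖χ.LFunction 1‖ ≤ 1 / Real.log D ^ 15 →
        ∃ ρ : ℝ, ρ < 1 ∧ χ.LFunction ρ = 0 ∧ deriv χ.LFunction ρ ≠ 0 ∧ χ ^ 2 = 1 ∧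
          1 - ρ ≤ K * (Real.log D ^ 15)⁻¹ ∧ 1 - ρ ≤ K * ‖χ.LFunction 1‖ ∧
          1 - c / Real.log (4 * D) < ρ ∧
          (∀ β : ℝ, 1 - c / Real.log (4 * D) < β → χ.LFunction β = 0 → β = ρ) := by
  obtain ⟨c, hc, A, hA, K, hK, H⟩ := exists_exceptionalZero_of_norm_LFunction_one_lt
  obtain ⟨D₀, hD₀⟩ := exists_nat_le_log' (max 2 (9 / A))
  refine ⟨D₀, K, hK, c, hc, fun D _ hD χ hχ h15 => ?_⟩
  have hlogD : max 2 (9 / A) ≤ Real.log D := hD₀ D hD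
  have hlog2 : 2 ≤ Real.log D := le_trans (le_max_left _ _) hlogD
  have hlog1 : 1 ≤ Real.log D := by linarith
  have hlog9 : 9 / A ≤ Real.log D := le_trans (le_max_right _ _) hlogD
  have hD0 : (0 : ℝ) < D := by exact_mod_cast Nat.pos_of_neZero D
  have hlog4D0 : 0 < Real.log (4 * D) := by
    have : Real.log D ≤ Real.log (4 * D) := Real.log_le_log hD0 (by linarith)
    linarith
  -- `(log D)⁻¹⁵ < A / (log 4D)²` for `D ≥ D₀`
  have hthr : 1 / Real.log D ^ 15 < A / Real.log (4 * D) ^ 2 := by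
    rw [div_lt_div_iff₀ (by positivity) (by positivity), one_mul]
    have h3 : Real.log (4 * D) ^ 2 ≤ (3 * Real.log D) ^ 2 :=
      pow_le_pow_left₀ hlog4D0.le (log_four_mul_le' hlog1 hD0) 2
    have h9 : 9 ≤ A * Real.log D := by rwa [div_le_iff₀' hA] at hlog9
    have hlt : Real.log D ^ 2 < Real.log D ^ 14 := by
      calc Real.log D ^ 2 = Real.log D ^ 2 * 1 := (mul_one _).symm
        _ < Real.log D ^ 2 * Real.log D ^ 12 :=
            mul_lt_mul_of_pos_left (one_lt_pow₀ (by linarith) (by norm_num)) (by positivity)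
        _ = Real.log D ^ 14 := by ring
    calc Real.log (4 * D) ^ 2 ≤ 9 * Real.log D ^ 2 := by nlinarith
      _ < 9 * Real.log D ^ 14 := by linarith
      _ ≤ A * Real.log D * Real.log D ^ 14 := by gcongr
      _ = A * Real.log D ^ 15 := by ring
  obtain ⟨ρ, hρc, hρ1, hρ0, hder, hsq, huniq, hK1, -⟩ := H D χ hχ (lt_of_le_of_lt h15 hthr)
  refine ⟨ρ, hρ1, hρ0, hder, hsq, ?_, hK1, hρc, huniq⟩
  rw [← one_div]
  exact hK1.trans (mul_le_mul_of_nonneg_left h15 hK.le)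

/-! ## The exceptional zero together with `1/L(s,χ)` next to it, under `‖L(1,χ)‖ ≤ 𝓛⁻¹⁵` -/

/-- **The exceptional zero and `1/L(s,χ)` next to it under the minimum premise** (twin of
`Lemma84.exceptional_package`, same absolute `c ∈ (0, 1/4]`, `C ≥ 0`, `K > 0`): for every `D ≥ D₀` and every
`χ ≠ χ₀ (mod D)` with `‖L(1,χ)‖ ≤ (log D)^{−15}`: a simple real zero `ρ̃ < 1` with `1 − ρ̃ ≤ K(log D)^{−15}`, and for every
`s ≠ ρ̃` with `Re s ≥ 1 − c/(log D + log(|Im s|+4))`: `L(s,χ) ≠ 0` and `‖L(s,χ)⁻¹‖ ≤ C·(log D + log(|Im s|+4))·(1 + |s − ρ̃|⁻¹)`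
(MV Thm 11.4, tree `DirichletZFR.exists_inv_LFunction_bounds`) — the input `hpack` of `Lemma84.lemma84Rel_of_lemma83Rel`
re-keyed from `𝓛⁻²⁰²²` to `𝓛⁻¹⁵`. [cite: Zhang2022LandauSiegel, §5 Lemma 5.5 (5.15)]
[cite: MontgomeryVaughan2007, Thm 11.4 (11.10)] -/
theorem exceptional_package_pow15 :
    ∃ c : ℝ, 0 < c ∧ c ≤ 1 / 4 ∧ ∃ C : ℝ, 0 ≤ C ∧ ∃ K : ℝ, 0 < K ∧ ∃ D₀ : ℕ,
      ∀ (D : ℕ) [NeZero D] (χ : DirichletCharacter ℂ D), D₀ ≤ D → χ ≠ 1 →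
        ‖χ.LFunction 1‖ ≤ 1 / Real.log D ^ 15 →
        ∃ ρ : ℝ, ρ < 1 ∧ 1 - ρ ≤ K * (Real.log D ^ 15)⁻¹ ∧ χ.LFunction ρ = 0 ∧
          deriv χ.LFunction ρ ≠ 0 ∧
          ∀ s : ℂ, 1 - c / (Real.log D + Real.log (|s.im| + 4)) ≤ s.re → s ≠ ρ →
            χ.LFunction s ≠ 0 ∧
            ‖(χ.LFunction s)⁻¹‖ ≤ C * (Real.log D + Real.log (|s.im| + 4)) * (1 + ‖s - ρ‖⁻¹) := by
  obtain ⟨c, hc, hc4, C, hC, -, -, -, hB⟩ := DirichletZFR.exists_inv_LFunction_bounds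
  obtain ⟨D₁, K, hK, c₅, -, H⟩ := lemma55_exceptionalZero_pow15
  -- `D` large enough that `K𝓛⁻¹⁵ < 2c/(𝓛 + log 4)`
  obtain ⟨D₂, hD₂⟩ := exists_nat_le_log' (max 2 (K / c))
  refine ⟨c, hc, hc4, C, hC, K, hK, max D₁ D₂, fun D _ χ hD hχ hA => ?_⟩
  have hD₁ : D₁ ≤ D := le_trans (le_max_left _ _) hD
  have hlog : max 2 (K / c) ≤ Real.log D := hD₂ D (le_trans (le_max_right _ _) hD)
  set 𝓛 : ℝ := Real.log D with h𝓛
  have h𝓛2 : 2 ≤ 𝓛 := le_trans (le_max_left _ _) hlog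
  have h𝓛K : K / c ≤ 𝓛 := le_trans (le_max_right _ _) hlog
  have h𝓛0 : 0 < 𝓛 := by linarith
  obtain ⟨ρ, hρ1, hρ0, hder, -, hKρ, -, -, -⟩ := H D hD₁ χ hχ hA
  have hlog4lt : Real.log 4 < 𝓛 := by
    have : Real.log 4 < 2 := by
      rw [Real.log_lt_iff_lt_exp (by norm_num)]
      have h1 := Real.exp_one_gt_d9
      have h2 : Real.exp 2 = Real.exp 1 * Real.exp 1 := by rw [← Real.exp_add]; norm_num
      nlinarith
    linarith
  have hlog4pos : 0 < Real.log 4 := Real.log_pos (by norm_num)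
  -- `1 − 2c/(𝓛 + log 4) < ρ`
  have hρc : 1 - 2 * c / (Real.log D + Real.log 4) < ρ := by
    have hKc : K ≤ c * 𝓛 := by rw [div_le_iff₀ hc] at h𝓛K; linarith
    have hpow : 𝓛 ^ 2 ≤ 𝓛 ^ 15 := by
      calc 𝓛 ^ 2 = 𝓛 ^ 2 * 1 := (mul_one _).symm
        _ ≤ 𝓛 ^ 2 * 𝓛 ^ 13 := by gcongr; exact one_le_pow₀ (by linarith)
        _ = 𝓛 ^ 15 := by ring
    have h1 : K * (𝓛 ^ 15)⁻¹ < 2 * c / (𝓛 + Real.log 4) := by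
      rw [← div_eq_mul_inv, div_lt_div_iff₀ (by positivity) (by positivity)]
      calc K * (𝓛 + Real.log 4) < K * (2 * 𝓛) := by
            apply mul_lt_mul_of_pos_left _ hK; linarith
        _ ≤ (c * 𝓛) * (2 * 𝓛) := by gcongr
        _ = 2 * c * 𝓛 ^ 2 := by ring
        _ ≤ 2 * c * 𝓛 ^ 15 := by gcongr
    rw [← h𝓛]
    linarith
  refine ⟨ρ, hρ1, hKρ, hρ0, hder, fun s hs hsρ => ?_⟩
  have hne : s ≠ (ρ : ℂ) := hsρ
  exact (hB D χ hχ ρ hρ0 hρc).2.2 s hs hne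

/-! ## (rev 2) The door's own minimum: every real exponent `E > 2` -/

/-- **Lemma 5.5 (first assertion, (5.15)) under `‖L(1,χ)‖ ≤ (log D)^{−E}` for ANY real `E > 2`** (rev 2; the exceptional-zero
door's own minimum premise, made literal): there are `D₀ = D₀(E)`, absolute `K, c > 0` such that for every `D ≥ D₀` and every
`χ ≠ χ₀ (mod D)` with `‖L(1,χ)‖ ≤ (log D)^{−E}`: a simple real zero `ρ̃ < 1`, `χ² = 1`, `1 − ρ̃ ≤ K(log D)^{−E}`,
`1 − ρ̃ ≤ K‖L(1,χ)‖`, unique in `(1 − c/log 4D, 1)`. Hecke–Landau's `‖L(1,χ)‖ < A/(log 4D)²` is met once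
`(log D)^{E−2} > 9/A`; `E = 2022` and `E = 15` are the two instances in the tree. [cite: Zhang2022LandauSiegel, §5 Lemma 5.5 (5.15)]
[cite: MontgomeryVaughan2007, Theorems 11.3–11.4] -/
theorem lemma55_exceptionalZero_of_rpow {E : ℝ} (hE : 2 < E) :
    ∃ D₀ : ℕ, ∃ K : ℝ, 0 < K ∧ ∃ c : ℝ, 0 < c ∧
      ∀ (D : ℕ) [NeZero D], D₀ ≤ D → ∀ χ : DirichletCharacter ℂ D, χ ≠ 1 →
        ‖χ.LFunction 1‖ ≤ 1 / Real.log D ^ E →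
        ∃ ρ : ℝ, ρ < 1 ∧ χ.LFunction ρ = 0 ∧ deriv χ.LFunction ρ ≠ 0 ∧ χ ^ 2 = 1 ∧
          1 - ρ ≤ K * (Real.log D ^ E)⁻¹ ∧ 1 - ρ ≤ K * ‖χ.LFunction 1‖ ∧
          1 - c / Real.log (4 * D) < ρ ∧
          (∀ β : ℝ, 1 - c / Real.log (4 * D) < β → χ.LFunction β = 0 → β = ρ) := by
  obtain ⟨c, hc, A, hA, K, hK, H⟩ := exists_exceptionalZero_of_norm_LFunction_one_lt
  have hE2 : 0 < E - 2 := by linarith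
  -- threshold: `log D ≥ 2` and `log D ≥ (9/A)^{1/(E−2)} + 1`, so that `(log D)^{E−2} > 9/A`
  obtain ⟨D₀, hD₀⟩ := exists_nat_le_log' (max 2 ((9 / A) ^ (1 / (E - 2)) + 1))
  refine ⟨D₀, K, hK, c, hc, fun D _ hD χ hχ hLE => ?_⟩
  have hlogD : max 2 ((9 / A) ^ (1 / (E - 2)) + 1) ≤ Real.log D := hD₀ D hD
  have hlog2 : 2 ≤ Real.log D := le_trans (le_max_left _ _) hlogD
  have hlog1 : 1 ≤ Real.log D := by linarith
  have hL0 : 0 < Real.log D := by linarith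
  have hlogM : (9 / A) ^ (1 / (E - 2)) + 1 ≤ Real.log D := le_trans (le_max_right _ _) hlogD
  have hD0 : (0 : ℝ) < D := by exact_mod_cast Nat.pos_of_neZero D
  have hlog4D0 : 0 < Real.log (4 * D) := by
    have : Real.log D ≤ Real.log (4 * D) := Real.log_le_log hD0 (by linarith)
    linarith
  -- `(log D)^{E−2} > 9/A`
  have hbase : 0 ≤ (9 / A) ^ (1 / (E - 2)) := by positivity
  have hpowgt : 9 / A < Real.log D ^ (E - 2) := by
    have hlt : (9 / A) ^ (1 / (E - 2)) < Real.log D := by linarith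
    have h1 : ((9 / A) ^ (1 / (E - 2))) ^ (E - 2) < Real.log D ^ (E - 2) :=
      Real.rpow_lt_rpow hbase hlt hE2
    rwa [← Real.rpow_mul (by positivity), one_div_mul_cancel hE2.ne', Real.rpow_one] at h1
  -- `(log D)^{−E} < A / (log 4D)²`
  have hpowE : Real.log D ^ E = Real.log D ^ (E - 2) * Real.log D ^ 2 := by
    rw [show Real.log D ^ 2 = Real.log D ^ (2 : ℝ) by rw [← Real.rpow_natCast]; norm_num,
      ← Real.rpow_add hL0]; ring_nf
  have hposE : 0 < Real.log D ^ E := Real.rpow_pos_of_pos hL0 _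
  have hthr : 1 / Real.log D ^ E < A / Real.log (4 * D) ^ 2 := by
    rw [div_lt_div_iff₀ hposE (by positivity), one_mul, hpowE]
    have h3 : Real.log (4 * D) ^ 2 ≤ (3 * Real.log D) ^ 2 :=
      pow_le_pow_left₀ hlog4D0.le (log_four_mul_le' hlog1 hD0) 2
    have h9 : 9 < A * Real.log D ^ (E - 2) := by
      have := mul_lt_mul_of_pos_left hpowgt hA
      rwa [mul_div_cancel₀ _ hA.ne'] at this
    have hL2 : 0 < Real.log D ^ 2 := by positivity
    calc Real.log (4 * D) ^ 2 ≤ 9 * Real.log D ^ 2 := by nlinarith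
      _ < A * Real.log D ^ (E - 2) * Real.log D ^ 2 := mul_lt_mul_of_pos_right h9 hL2
      _ = A * (Real.log D ^ (E - 2) * Real.log D ^ 2) := by ring
  obtain ⟨ρ, hρc, hρ1, hρ0, hder, hsq, huniq, hK1, -⟩ := H D χ hχ (lt_of_le_of_lt hLE hthr)
  refine ⟨ρ, hρ1, hρ0, hder, hsq, ?_, hK1, hρc, huniq⟩
  rw [← one_div]
  exact hK1.trans (mul_le_mul_of_nonneg_left hLE hK.le)

end Literature.NumberTheory.LFunctions.Zhang2022.Repair.Gap
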